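import Summits.AtomisticToContinuum.BoseEinsteinCondensation.Theorems.SoloBlindBoxLatticeSymbol

/-!
# Box-lattice symbol of a momentum cutoff, three dimensions

(Solo paper §13.8, Proposition 13.9, step (2); companion of `SoloBlindBoxLatticeSymbol`.)
From the one-dimensional facts `Σ_{n∈ℤ} sinc²(π(x+n)) = 1` and
`Σ_{n∈ℤ, |x+n| ≥ K} sinc²(π(x+n)) ≤ 4/(π²K)` (`K ≥ 1`) we derive, by Fubini–Tonelli for nonnegative
families on `ℤ³ = ℤ × (ℤ × ℤ)` and the union bound over the three lattice axes:

* `tsum_sinc_sq_prod3` — **Parseval for the box basis**: `Σ_{n∈ℤ³} Π_i sinc²(π(x_i+n_i)) = 1`;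
* `tsum_sinc_sq_prod3_tail_le` — `Σ_{n∈ℤ³, ‖x+n‖_∞ ≥ K} Π_i sinc²(π(x_i+n_i)) ≤ 12/(π²K)`;
* `tsum_sinc_sq_prod3_euclid_tail_le` — the same under the Euclidean condition `|x+n| ≥ √3·K`.

With `x = θR/(2π)` (lattice momentum `θ`, boxes of side `R`) and `√3·K = k₀R/(2π)` the last bound
is `sup_θ m(θ) ≤ 24√3/(π k₀ R)` for `k₀R ≥ 2π√3`, where
`m(θ) = Σ_{G∈(2π/R)ℤ³, |θ+G| ≥ k₀} Π_i sinc²((θ_i+G_i)R/2)` is the symbol of `PΠ_{|p| ≥ k₀}P`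
(`P` = projection onto the box constants): `‖PΠ_{|p|>k₀}P‖ ≤ C/(k₀R)`, as quoted in
Prop. 13.9(2).
-/

noncomputable section

open Real Filter Finset

namespace Summit.AtomisticToContinuum.BoseEinsteinCondensation.Theorems

/-! ## Tonelli for nonnegative real families on a product index -/

/-- Product sums of nonnegative summable real families (Fubini–Tonelli on `ι × κ`). -/
theorem tsum_prod_mul_eq {ι κ : Type*} {f : ι → ℝ} {g : κ → ℝ} (hf : Summable f)
    (hg : Summable g) (hf0 : ∀ i, 0 ≤ f i) (hg0 : ∀ k, 0 ≤ g k) :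
    ∑' z : ι × κ, f z.1 * g z.2 = (∑' i, f i) * ∑' k, g k := by
  have hf' : Summable (fun i => ‖f i‖) :=
    hf.congr (fun i => (Real.norm_of_nonneg (hf0 i)).symm)
  have hg' : Summable (fun k => ‖g k‖) :=
    hg.congr (fun k => (Real.norm_of_nonneg (hg0 k)).symm)
  exact (tsum_mul_tsum_of_summable_norm hf' hg').symm

/-- The product of two nonnegative summable real families is summable on the product index. -/
theorem summable_prod_mul {ι κ : Type*} {f : ι → ℝ} {g : κ → ℝ} (hf : Summable f)
    (hg : Summable g) (hf0 : ∀ i, 0 ≤ f i) (hg0 : ∀ k, 0 ≤ g k) :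
    Summable (fun z : ι × κ => f z.1 * g z.2) :=
  summable_mul_of_summable_norm (hf.congr (fun i => (Real.norm_of_nonneg (hf0 i)).symm))
    (hg.congr (fun k => (Real.norm_of_nonneg (hg0 k)).symm))

/-! ## Pointwise nonnegativity -/

/-- `sinc²(π(x+n)) ≥ 0`. -/
theorem sinc_sq_pi_mul_add_int_nonneg (x : ℝ) (n : ℤ) : 0 ≤ Real.sinc (π * (x + n)) ^ 2 := sq_nonneg _

/-- Indicator-restricted terms `1_{p(n)} sinc²(π(x+n))` are nonnegative. -/
theorem ite_sinc_sq_nonneg (x : ℝ) (p : ℤ → Prop) [DecidablePred p] (n : ℤ) :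
    0 ≤ (if p n then Real.sinc (π * (x + n)) ^ 2 else 0) := by
  split_ifs
  · exact sq_nonneg _
  · exact le_rfl

/-- Indicator-restricted terms of the three-dimensional weight are nonnegative. -/
theorem ite_sinc_sq_prod3_nonneg (x₁ x₂ x₃ : ℝ) (q : Prop) [Decidable q] (n : ℤ × ℤ × ℤ) :
    0 ≤ (if q then Real.sinc (π * (x₁ + n.1)) ^ 2
        * (Real.sinc (π * (x₂ + n.2.1)) ^ 2 * Real.sinc (π * (x₃ + n.2.2)) ^ 2) else 0) := by
  split_ifs
  · exact mul_nonneg (sq_nonneg _) (mul_nonneg (sq_nonneg _) (sq_nonneg _))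
  · exact le_rfl

/-! ## Parseval for the box basis in two and three dimensions -/

/-- The two-dimensional weight is summable on `ℤ × ℤ`. -/
theorem summable_sinc_sq_prod2 (x₂ x₃ : ℝ) :
    Summable (fun m : ℤ × ℤ => Real.sinc (π * (x₂ + m.1)) ^ 2 * Real.sinc (π * (x₃ + m.2)) ^ 2) := by
  have h := summable_prod_mul (hasSum_sinc_sq_int x₂).summable (hasSum_sinc_sq_int x₃).summable
    (sinc_sq_pi_mul_add_int_nonneg x₂) (sinc_sq_pi_mul_add_int_nonneg x₃)
  exact h

/-- `Σ_{m∈ℤ²} sinc²(π(x₂+m₁)) sinc²(π(x₃+m₂)) = 1`. -/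
theorem tsum_sinc_sq_prod2 (x₂ x₃ : ℝ) :
    ∑' m : ℤ × ℤ, Real.sinc (π * (x₂ + m.1)) ^ 2 * Real.sinc (π * (x₃ + m.2)) ^ 2 = 1 := by
  have h := tsum_prod_mul_eq (hasSum_sinc_sq_int x₂).summable (hasSum_sinc_sq_int x₃).summable
    (sinc_sq_pi_mul_add_int_nonneg x₂) (sinc_sq_pi_mul_add_int_nonneg x₃)
  rw [tsum_sinc_sq_int, tsum_sinc_sq_int, mul_one] at h
  exact h

/-- The three-dimensional weight `Π_i sinc²(π(x_i+n_i))` is summable on `ℤ³`. -/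
theorem summable_sinc_sq_prod3 (x₁ x₂ x₃ : ℝ) :
    Summable (fun n : ℤ × ℤ × ℤ => Real.sinc (π * (x₁ + n.1)) ^ 2
        * (Real.sinc (π * (x₂ + n.2.1)) ^ 2 * Real.sinc (π * (x₃ + n.2.2)) ^ 2)) := by
  have h := summable_prod_mul (hasSum_sinc_sq_int x₁).summable (summable_sinc_sq_prod2 x₂ x₃)
    (sinc_sq_pi_mul_add_int_nonneg x₁)
    (fun m => mul_nonneg (sinc_sq_pi_mul_add_int_nonneg _ _) (sinc_sq_pi_mul_add_int_nonneg _ _))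
  exact h

/-- **Parseval for the box basis in three dimensions**:
`Σ_{n∈ℤ³} Π_i sinc²(π(x_i+n_i)) = 1`. -/
theorem tsum_sinc_sq_prod3 (x₁ x₂ x₃ : ℝ) :
    ∑' n : ℤ × ℤ × ℤ, Real.sinc (π * (x₁ + n.1)) ^ 2
        * (Real.sinc (π * (x₂ + n.2.1)) ^ 2 * Real.sinc (π * (x₃ + n.2.2)) ^ 2) = 1 := by
  have h := tsum_prod_mul_eq (hasSum_sinc_sq_int x₁).summable (summable_sinc_sq_prod2 x₂ x₃)
    (sinc_sq_pi_mul_add_int_nonneg x₁)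
    (fun m => mul_nonneg (sinc_sq_pi_mul_add_int_nonneg _ _) (sinc_sq_pi_mul_add_int_nonneg _ _))
  rw [tsum_sinc_sq_int, tsum_sinc_sq_prod2, mul_one] at h
  exact h

/-- Indicator-restricted sub-families of the three-dimensional weight are summable. -/
theorem summable_ite_sinc_sq_prod3 (x₁ x₂ x₃ : ℝ) (p : ℤ × ℤ × ℤ → Prop) [DecidablePred p] :
    Summable (fun n : ℤ × ℤ × ℤ => if p n then Real.sinc (π * (x₁ + n.1)) ^ 2
        * (Real.sinc (π * (x₂ + n.2.1)) ^ 2 * Real.sinc (π * (x₃ + n.2.2)) ^ 2) else 0) :=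
  (summable_sinc_sq_prod3 x₁ x₂ x₃).of_nonneg_of_le
    (fun n => by
      split_ifs
      · exact mul_nonneg (sq_nonneg _) (mul_nonneg (sq_nonneg _) (sq_nonneg _))
      · exact le_rfl)
    (fun n => by
      split_ifs
      · exact le_rfl
      · exact mul_nonneg (sq_nonneg _) (mul_nonneg (sq_nonneg _) (sq_nonneg _)))

/-! ## Tails along the three axes -/

/-- Tail along the first axis: `Σ_{|x₁+n₁| ≥ K} Π_i sinc² ≤ 4/(π²K)`. -/
theorem tsum_sinc_sq_prod3_tail₁_le {K : ℝ} (hK : 1 ≤ K) (x₁ x₂ x₃ : ℝ) :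
    ∑' n : ℤ × ℤ × ℤ, (if K ≤ |x₁ + n.1| then Real.sinc (π * (x₁ + n.1)) ^ 2
        * (Real.sinc (π * (x₂ + n.2.1)) ^ 2 * Real.sinc (π * (x₃ + n.2.2)) ^ 2) else 0)
      ≤ 4 / (π ^ 2 * K) := by
  have ht : Summable (fun k : ℤ => if K ≤ |x₁ + k| then Real.sinc (π * (x₁ + k)) ^ 2 else 0) :=
    summable_ite_sinc_sq x₁ _
  have h := tsum_prod_mul_eq ht (summable_sinc_sq_prod2 x₂ x₃)
    (ite_sinc_sq_nonneg x₁ (fun k : ℤ => K ≤ |x₁ + k|))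
    (fun m => mul_nonneg (sinc_sq_pi_mul_add_int_nonneg _ _) (sinc_sq_pi_mul_add_int_nonneg _ _))
  rw [tsum_sinc_sq_prod2, mul_one] at h
  calc ∑' n : ℤ × ℤ × ℤ, (if K ≤ |x₁ + n.1| then Real.sinc (π * (x₁ + n.1)) ^ 2
        * (Real.sinc (π * (x₂ + n.2.1)) ^ 2 * Real.sinc (π * (x₃ + n.2.2)) ^ 2) else 0)
      = ∑' n : ℤ × ℤ × ℤ, (if K ≤ |x₁ + n.1| then Real.sinc (π * (x₁ + n.1)) ^ 2 else 0)
          * (Real.sinc (π * (x₂ + n.2.1)) ^ 2 * Real.sinc (π * (x₃ + n.2.2)) ^ 2) := by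
        refine tsum_congr fun n => ?_
        split_ifs <;> simp
    _ = ∑' k : ℤ, (if K ≤ |x₁ + k| then Real.sinc (π * (x₁ + k)) ^ 2 else 0) := h
    _ ≤ 4 / (π ^ 2 * K) := tsum_sinc_sq_tail_le hK x₁

/-- Tail along the second axis: `Σ_{|x₂+n₂| ≥ K} Π_i sinc² ≤ 4/(π²K)`. -/
theorem tsum_sinc_sq_prod3_tail₂_le {K : ℝ} (hK : 1 ≤ K) (x₁ x₂ x₃ : ℝ) :
    ∑' n : ℤ × ℤ × ℤ, (if K ≤ |x₂ + n.2.1| then Real.sinc (π * (x₁ + n.1)) ^ 2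
        * (Real.sinc (π * (x₂ + n.2.1)) ^ 2 * Real.sinc (π * (x₃ + n.2.2)) ^ 2) else 0)
      ≤ 4 / (π ^ 2 * K) := by
  have ht : Summable (fun k : ℤ => if K ≤ |x₂ + k| then Real.sinc (π * (x₂ + k)) ^ 2 else 0) :=
    summable_ite_sinc_sq x₂ _
  have hG := summable_prod_mul ht (hasSum_sinc_sq_int x₃).summable
      (ite_sinc_sq_nonneg x₂ (fun k : ℤ => K ≤ |x₂ + k|)) (sinc_sq_pi_mul_add_int_nonneg x₃)
  have hG0 : ∀ m : ℤ × ℤ,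
      0 ≤ (if K ≤ |x₂ + m.1| then Real.sinc (π * (x₂ + m.1)) ^ 2 else 0) * Real.sinc (π * (x₃ + m.2)) ^ 2 :=
    fun m => mul_nonneg (ite_sinc_sq_nonneg x₂ (fun k : ℤ => K ≤ |x₂ + k|) m.1)
      (sinc_sq_pi_mul_add_int_nonneg _ _)
  have h2 := tsum_prod_mul_eq ht (hasSum_sinc_sq_int x₃).summable
    (ite_sinc_sq_nonneg x₂ (fun k : ℤ => K ≤ |x₂ + k|)) (sinc_sq_pi_mul_add_int_nonneg x₃)
  rw [tsum_sinc_sq_int, mul_one] at h2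
  have h3 := tsum_prod_mul_eq (hasSum_sinc_sq_int x₁).summable hG
    (sinc_sq_pi_mul_add_int_nonneg x₁) hG0
  rw [tsum_sinc_sq_int, one_mul, h2] at h3
  calc ∑' n : ℤ × ℤ × ℤ, (if K ≤ |x₂ + n.2.1| then Real.sinc (π * (x₁ + n.1)) ^ 2
        * (Real.sinc (π * (x₂ + n.2.1)) ^ 2 * Real.sinc (π * (x₃ + n.2.2)) ^ 2) else 0)
      = ∑' n : ℤ × ℤ × ℤ, Real.sinc (π * (x₁ + n.1)) ^ 2
          * ((if K ≤ |x₂ + n.2.1| then Real.sinc (π * (x₂ + n.2.1)) ^ 2 else 0) * Real.sinc (π * (x₃ + n.2.2)) ^ 2) := by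
        refine tsum_congr fun n => ?_
        split_ifs <;> simp
    _ = ∑' k : ℤ, (if K ≤ |x₂ + k| then Real.sinc (π * (x₂ + k)) ^ 2 else 0) := h3
    _ ≤ 4 / (π ^ 2 * K) := tsum_sinc_sq_tail_le hK x₂

/-- Tail along the third axis: `Σ_{|x₃+n₃| ≥ K} Π_i sinc² ≤ 4/(π²K)`. -/
theorem tsum_sinc_sq_prod3_tail₃_le {K : ℝ} (hK : 1 ≤ K) (x₁ x₂ x₃ : ℝ) :
    ∑' n : ℤ × ℤ × ℤ, (if K ≤ |x₃ + n.2.2| then Real.sinc (π * (x₁ + n.1)) ^ 2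
        * (Real.sinc (π * (x₂ + n.2.1)) ^ 2 * Real.sinc (π * (x₃ + n.2.2)) ^ 2) else 0)
      ≤ 4 / (π ^ 2 * K) := by
  have ht : Summable (fun k : ℤ => if K ≤ |x₃ + k| then Real.sinc (π * (x₃ + k)) ^ 2 else 0) :=
    summable_ite_sinc_sq x₃ _
  have hG := summable_prod_mul (hasSum_sinc_sq_int x₂).summable ht
      (sinc_sq_pi_mul_add_int_nonneg x₂) (ite_sinc_sq_nonneg x₃ (fun k : ℤ => K ≤ |x₃ + k|))
  have hG0 : ∀ m : ℤ × ℤ,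
      0 ≤ Real.sinc (π * (x₂ + m.1)) ^ 2 * (if K ≤ |x₃ + m.2| then Real.sinc (π * (x₃ + m.2)) ^ 2 else 0) :=
    fun m => mul_nonneg (sinc_sq_pi_mul_add_int_nonneg _ _)
      (ite_sinc_sq_nonneg x₃ (fun k : ℤ => K ≤ |x₃ + k|) m.2)
  have h2 := tsum_prod_mul_eq (hasSum_sinc_sq_int x₂).summable ht
    (sinc_sq_pi_mul_add_int_nonneg x₂) (ite_sinc_sq_nonneg x₃ (fun k : ℤ => K ≤ |x₃ + k|))
  rw [tsum_sinc_sq_int, one_mul] at h2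
  have h3 := tsum_prod_mul_eq (hasSum_sinc_sq_int x₁).summable hG
    (sinc_sq_pi_mul_add_int_nonneg x₁) hG0
  rw [tsum_sinc_sq_int, one_mul, h2] at h3
  calc ∑' n : ℤ × ℤ × ℤ, (if K ≤ |x₃ + n.2.2| then Real.sinc (π * (x₁ + n.1)) ^ 2
        * (Real.sinc (π * (x₂ + n.2.1)) ^ 2 * Real.sinc (π * (x₃ + n.2.2)) ^ 2) else 0)
      = ∑' n : ℤ × ℤ × ℤ, Real.sinc (π * (x₁ + n.1)) ^ 2
          * (Real.sinc (π * (x₂ + n.2.1)) ^ 2 * (if K ≤ |x₃ + n.2.2| then Real.sinc (π * (x₃ + n.2.2)) ^ 2 else 0)) := by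
        refine tsum_congr fun n => ?_
        split_ifs <;> simp
    _ = ∑' k : ℤ, (if K ≤ |x₃ + k| then Real.sinc (π * (x₃ + k)) ^ 2 else 0) := h3
    _ ≤ 4 / (π ^ 2 * K) := tsum_sinc_sq_tail_le hK x₃

/-! ## The symbol bound -/

/-- **The symbol bound** (sup-norm form): for `K ≥ 1` and every `x ∈ ℝ³`,
`Σ_{n∈ℤ³, ‖x+n‖_∞ ≥ K} Π_i sinc²(π(x_i+n_i)) ≤ 12/(π²K)`. -/
theorem tsum_sinc_sq_prod3_tail_le {K : ℝ} (hK : 1 ≤ K) (x₁ x₂ x₃ : ℝ) :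
    ∑' n : ℤ × ℤ × ℤ,
        (if K ≤ max |x₁ + n.1| (max |x₂ + n.2.1| |x₃ + n.2.2|) then Real.sinc (π * (x₁ + n.1)) ^ 2
        * (Real.sinc (π * (x₂ + n.2.1)) ^ 2 * Real.sinc (π * (x₃ + n.2.2)) ^ 2) else 0)
      ≤ 12 / (π ^ 2 * K) := by
  have hle : ∀ n : ℤ × ℤ × ℤ,
      (if K ≤ max |x₁ + n.1| (max |x₂ + n.2.1| |x₃ + n.2.2|) then Real.sinc (π * (x₁ + n.1)) ^ 2
        * (Real.sinc (π * (x₂ + n.2.1)) ^ 2 * Real.sinc (π * (x₃ + n.2.2)) ^ 2) else 0)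
        ≤ (if K ≤ |x₁ + n.1| then Real.sinc (π * (x₁ + n.1)) ^ 2
        * (Real.sinc (π * (x₂ + n.2.1)) ^ 2 * Real.sinc (π * (x₃ + n.2.2)) ^ 2) else 0)
          + (if K ≤ |x₂ + n.2.1| then Real.sinc (π * (x₁ + n.1)) ^ 2
        * (Real.sinc (π * (x₂ + n.2.1)) ^ 2 * Real.sinc (π * (x₃ + n.2.2)) ^ 2) else 0)
          + (if K ≤ |x₃ + n.2.2| then Real.sinc (π * (x₁ + n.1)) ^ 2
        * (Real.sinc (π * (x₂ + n.2.1)) ^ 2 * Real.sinc (π * (x₃ + n.2.2)) ^ 2) else 0) := by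
    intro n
    have h1 := ite_sinc_sq_prod3_nonneg x₁ x₂ x₃ (K ≤ |x₁ + n.1|) n
    have h2 := ite_sinc_sq_prod3_nonneg x₁ x₂ x₃ (K ≤ |x₂ + n.2.1|) n
    have h3 := ite_sinc_sq_prod3_nonneg x₁ x₂ x₃ (K ≤ |x₃ + n.2.2|) n
    by_cases h : K ≤ max |x₁ + n.1| (max |x₂ + n.2.1| |x₃ + n.2.2|)
    · rw [if_pos h]
      rcases le_max_iff.1 h with h' | h'
      · rw [if_pos h'] at h1 ⊢
        linarith
      · rcases le_max_iff.1 h' with h'' | h''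
        · rw [if_pos h''] at h2 ⊢
          linarith
        · rw [if_pos h''] at h3 ⊢
          linarith
    · rw [if_neg h]
      linarith
  have s₁ := summable_ite_sinc_sq_prod3 x₁ x₂ x₃ (fun n => K ≤ |x₁ + n.1|)
  have s₂ := summable_ite_sinc_sq_prod3 x₁ x₂ x₃ (fun n => K ≤ |x₂ + n.2.1|)
  have s₃ := summable_ite_sinc_sq_prod3 x₁ x₂ x₃ (fun n => K ≤ |x₃ + n.2.2|)
  calc ∑' n : ℤ × ℤ × ℤ,
        (if K ≤ max |x₁ + n.1| (max |x₂ + n.2.1| |x₃ + n.2.2|) then Real.sinc (π * (x₁ + n.1)) ^ 2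
        * (Real.sinc (π * (x₂ + n.2.1)) ^ 2 * Real.sinc (π * (x₃ + n.2.2)) ^ 2) else 0)
      ≤ ∑' n : ℤ × ℤ × ℤ, ((if K ≤ |x₁ + n.1| then Real.sinc (π * (x₁ + n.1)) ^ 2
        * (Real.sinc (π * (x₂ + n.2.1)) ^ 2 * Real.sinc (π * (x₃ + n.2.2)) ^ 2) else 0)
          + (if K ≤ |x₂ + n.2.1| then Real.sinc (π * (x₁ + n.1)) ^ 2
        * (Real.sinc (π * (x₂ + n.2.1)) ^ 2 * Real.sinc (π * (x₃ + n.2.2)) ^ 2) else 0)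
          + (if K ≤ |x₃ + n.2.2| then Real.sinc (π * (x₁ + n.1)) ^ 2
        * (Real.sinc (π * (x₂ + n.2.1)) ^ 2 * Real.sinc (π * (x₃ + n.2.2)) ^ 2) else 0)) :=
        Summable.tsum_le_tsum hle (summable_ite_sinc_sq_prod3 x₁ x₂ x₃ _) ((s₁.add s₂).add s₃)
    _ = ∑' n : ℤ × ℤ × ℤ, (if K ≤ |x₁ + n.1| then Real.sinc (π * (x₁ + n.1)) ^ 2
        * (Real.sinc (π * (x₂ + n.2.1)) ^ 2 * Real.sinc (π * (x₃ + n.2.2)) ^ 2) else 0)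
          + ∑' n : ℤ × ℤ × ℤ, (if K ≤ |x₂ + n.2.1| then Real.sinc (π * (x₁ + n.1)) ^ 2
        * (Real.sinc (π * (x₂ + n.2.1)) ^ 2 * Real.sinc (π * (x₃ + n.2.2)) ^ 2) else 0)
          + ∑' n : ℤ × ℤ × ℤ, (if K ≤ |x₃ + n.2.2| then Real.sinc (π * (x₁ + n.1)) ^ 2
        * (Real.sinc (π * (x₂ + n.2.1)) ^ 2 * Real.sinc (π * (x₃ + n.2.2)) ^ 2) else 0) := by
        rw [(s₁.add s₂).tsum_add s₃, s₁.tsum_add s₂]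
    _ ≤ 4 / (π ^ 2 * K) + 4 / (π ^ 2 * K) + 4 / (π ^ 2 * K) :=
        add_le_add (add_le_add (tsum_sinc_sq_prod3_tail₁_le hK x₁ x₂ x₃)
          (tsum_sinc_sq_prod3_tail₂_le hK x₁ x₂ x₃)) (tsum_sinc_sq_prod3_tail₃_le hK x₁ x₂ x₃)
    _ = 12 / (π ^ 2 * K) := by ring

/-- **The symbol bound, Euclidean form** (as quoted in Prop. 13.9(2)): for `K ≥ 1`,
`Σ_{n∈ℤ³, |x+n| ≥ √3·K} Π_i sinc²(π(x_i+n_i)) ≤ 12/(π²K)`; with `x = θR/(2π)` and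
`√3·K = k₀R/(2π)` this reads `sup_θ m(θ) ≤ 24√3/(π k₀ R)` for `k₀R ≥ 2π√3`. -/
theorem tsum_sinc_sq_prod3_euclid_tail_le {K : ℝ} (hK : 1 ≤ K) (x₁ x₂ x₃ : ℝ) :
    ∑' n : ℤ × ℤ × ℤ,
        (if Real.sqrt 3 * K ≤ Real.sqrt ((x₁ + n.1) ^ 2 + (x₂ + n.2.1) ^ 2 + (x₃ + n.2.2) ^ 2)
          then Real.sinc (π * (x₁ + n.1)) ^ 2
        * (Real.sinc (π * (x₂ + n.2.1)) ^ 2 * Real.sinc (π * (x₃ + n.2.2)) ^ 2) else 0)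
      ≤ 12 / (π ^ 2 * K) := by
  have hK0 : 0 < K := by linarith
  have hle : ∀ n : ℤ × ℤ × ℤ,
      (if Real.sqrt 3 * K ≤ Real.sqrt ((x₁ + n.1) ^ 2 + (x₂ + n.2.1) ^ 2 + (x₃ + n.2.2) ^ 2)
          then Real.sinc (π * (x₁ + n.1)) ^ 2
        * (Real.sinc (π * (x₂ + n.2.1)) ^ 2 * Real.sinc (π * (x₃ + n.2.2)) ^ 2) else 0)
        ≤ (if K ≤ max |x₁ + n.1| (max |x₂ + n.2.1| |x₃ + n.2.2|)
            then Real.sinc (π * (x₁ + n.1)) ^ 2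
        * (Real.sinc (π * (x₂ + n.2.1)) ^ 2 * Real.sinc (π * (x₃ + n.2.2)) ^ 2) else 0) := by
    intro n
    by_cases h : Real.sqrt 3 * K
        ≤ Real.sqrt ((x₁ + n.1) ^ 2 + (x₂ + n.2.1) ^ 2 + (x₃ + n.2.2) ^ 2)
    · have hmax : K ≤ max |x₁ + n.1| (max |x₂ + n.2.1| |x₃ + n.2.2|) := by
        by_contra hlt
        rw [not_le] at hlt
        have ha : |x₁ + n.1| < K := lt_of_le_of_lt (le_max_left _ _) hlt
        have hb : |x₂ + n.2.1| < K :=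
          lt_of_le_of_lt (le_trans (le_max_left _ _) (le_max_right _ _)) hlt
        have hc : |x₃ + n.2.2| < K :=
          lt_of_le_of_lt (le_trans (le_max_right _ _) (le_max_right _ _)) hlt
        have ha2 : (x₁ + n.1) ^ 2 < K ^ 2 := sq_lt_sq' (abs_lt.1 ha).1 (abs_lt.1 ha).2
        have hb2 : (x₂ + n.2.1) ^ 2 < K ^ 2 := sq_lt_sq' (abs_lt.1 hb).1 (abs_lt.1 hb).2
        have hc2 : (x₃ + n.2.2) ^ 2 < K ^ 2 := sq_lt_sq' (abs_lt.1 hc).1 (abs_lt.1 hc).2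
        have hsum : (x₁ + n.1) ^ 2 + (x₂ + n.2.1) ^ 2 + (x₃ + n.2.2) ^ 2 < 3 * K ^ 2 := by
          linarith
        have hlt' : Real.sqrt ((x₁ + n.1) ^ 2 + (x₂ + n.2.1) ^ 2 + (x₃ + n.2.2) ^ 2)
            < Real.sqrt 3 * K := by
          calc Real.sqrt ((x₁ + n.1) ^ 2 + (x₂ + n.2.1) ^ 2 + (x₃ + n.2.2) ^ 2)
              < Real.sqrt (3 * K ^ 2) := Real.sqrt_lt_sqrt (by positivity) hsum
            _ = Real.sqrt 3 * K := by
                rw [Real.sqrt_mul (by norm_num : (0 : ℝ) ≤ 3), Real.sqrt_sq hK0.le]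
        linarith
      rw [if_pos h, if_pos hmax]
    · rw [if_neg h]
      exact ite_sinc_sq_prod3_nonneg x₁ x₂ x₃ _ n
  exact le_trans (Summable.tsum_le_tsum hle (summable_ite_sinc_sq_prod3 x₁ x₂ x₃ _)
    (summable_ite_sinc_sq_prod3 x₁ x₂ x₃ _)) (tsum_sinc_sq_prod3_tail_le hK x₁ x₂ x₃)

end Summit.AtomisticToContinuum.BoseEinsteinCondensation.Theorems
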